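import Summits.QuantumFields.YangMills.Theorems.LuscherReductionDressedRitzPolyakovLiftEuclideanCurrency
import HarnessLib

/-!
# Route `LuscherReduction`, item `DressedRitz` (stmt-QuantumFields-20205), line «polyakovlift» r5 — ALL clause groups of the line in EUCLIDEAN currency:
# (o0)(o2) statics, (o5)(o6) core dynamics, (o4) leakage are statements about the normalised connected correlators `corr_t`, `t ∈ {2L, 2L+1, 2L+2}`

Support module (LEAD prover ym-lead-20205-polyakovlift g0; `--supports stmt-QuantumFields-20205`, helper).  Companion of `…PolyakovLiftEuclideanCurrency.lean`
(`corr β φ G t i l = ⟨ins φ G_i, K_β^[t](ins φ G_l)⟩/λ₀^t`, the slab limit of `VacDict.tendsto_feynmanKac`).  For the dressed family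
`u_i = K_β^[m](ins φ G_i)` (`m = dressSteps L`, `G_i = flowLiftAt 0 (flowTime β L) g_i`) every power of the top value `λ₀` CANCELS from the line's clauses:

* `staticClauses_iff_corr`      — S-STAT:  (o0) `corr_{2m,ii} > 0`;  (o2) `|corr_{2m,il}| ≤ Cλ·√(corr_{2m,ii}corr_{2m,ll})`;
* `dynamicCoreClauses_iff_corr` — S-POS:   (o5) `corr_{2m+1,ii}·μ₀ = e^{±Cλ²/L}·μ_{i+1}·corr_{2m,ii}` (the per-step effective mass of channel `i`, vacuum energy
                                   removed, sits at the one-site level ratio `μ_{i+1}/μ₀`);  (o6) normalised symmetrised off-diagonal defect `≤ C(λ²/L)√(…)`;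
* `leakageClause_iff_corr`      — S-LEAK:  (o4) the LOG-CONVEXITY DEFECT `corr_{2m+2,ii}·corr_{2m,ii} − corr_{2m+1,ii}² ≤ C(λ³/L²)·corr_{2m,ii}²` — the
                                   effective mass has PLATEAUED between separations `2m → 2m+1` and `2m+1 → 2m+2` (single-state dominance at time 2).
So the four registered stubs are claims about ratios of free-boundary slab path integrals with two constant-subtracted flowed-Polyakov insertions at
separations `2L, 2L+1, 2L+2` (and, for S-UNIV′/S-PSCAL, their one-site shadows) — one currency for the renormalisation-group work.

HONEST FRAMING: fixed-lattice bookkeeping on the conditional femto rung R2b1; all four stubs OPEN; nothing here bears on infinite volume, the continuum limit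
or the Clay gap.  References: M. Lüscher, U. Wolff, NPB 339 (1990) 222 [cite: LuscherWolff1990]; M. Lüscher, NPB 219 (1983) 233 [cite: Luscher1983, §3].
-/

set_option autoImplicit false

noncomputable section

open MeasureTheory Filter Topology Real
open Literature.MathematicalPhysics.QuantumFieldTheory (GaugeConfig Site gaugeTransform)
open scoped BigOperators

namespace Summit.QuantumFields.YangMills.Theorems.FemtoTransferGap.PolyakovLift

open Summit.QuantumFields.YangMills.Theorems.FemtoTransferGap

/-! ## §1 Scalar helpers: cancelling a positive factor -/

/-- `P·a ≤ P·b ↔ a ≤ b` for `P > 0`, with the products given by name. [folklore] -/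
theorem le_iff_of_eq_pos_mul {P a b X Y : ℝ} (hP : 0 < P) (hX : X = P * a) (hY : Y = P * b) : (X ≤ Y ↔ a ≤ b) := by
  subst hX; subst hY
  exact ⟨fun h => le_of_mul_le_mul_left h hP, fun h => mul_le_mul_of_nonneg_left h hP.le⟩

/-- `0 < P·a ↔ 0 < a` for `P > 0`, with the product given by name. [folklore] -/
theorem pos_iff_of_eq_pos_mul {P a X : ℝ} (hP : 0 < P) (hX : X = P * a) : (0 < X ↔ 0 < a) := by
  subst hX
  exact ⟨fun h => pos_of_mul_pos_right h hP.le, fun h => mul_pos hP h⟩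

/-- The two-step Gram number of two `m`-dressed insertions is `λ₀^{2m+2}·corr(2m+2)`. [folklore] -/
theorem corr_dressed_normK {M : ℕ} [NeZero M] {k : ℕ} {β : ℝ} (hβ : 0 < β) {φ : GaugeConfig 3 M SU2 → ℝ} (hφ : IsPhys φ)
    {G : Fin k → (GaugeConfig 3 M SU2 → ℝ)} (hG : ∀ i, IsPhys (G i)) (m : ℕ) (i l : Fin k) :
    l2 (transferApply β ((transferApply (L := M) β)^[m] (OpPlat.ins φ (G i))))
        (transferApply β ((transferApply β)^[m] (OpPlat.ins φ (G l)))) =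
      levelValue su2Rep M β 0 ^ (2 * m + 2) * corr β φ G (2 * m + 2) i l := by
  have hl0 : 0 < levelValue su2Rep M β 0 := levelValue_su2Rep_pos hβ 0
  rw [corr, mul_div_cancel₀ _ (pow_ne_zero _ hl0.ne'), ← Function.iterate_succ_apply' (transferApply β) m,
    ← Function.iterate_succ_apply' (transferApply β) m,
    l2_iterate_polar β (OpPlat.isPhys_ins hφ (hG i)) (OpPlat.isPhys_ins hφ (hG l))]
  congr 2; omega

/-! ## §2 The dictionary for the dressed lift family -/

section Dressed

variable {L : ℕ} [NeZero L] {k : ℕ} {β : ℝ} {φ : GaugeConfig 3 L SU2 → ℝ} {g : Fin k → (GaugeConfig 3 1 SU2 → ℝ)}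

/-- ★ **S-STAT in Euclidean currency**: `StaticClauses k C β (dressedLiftFamily β φ g)` ⟺ (o0) `corr_{2m,ii} > 0` ∧ (o2)
`|corr_{2m,il}| ≤ Cλ√(corr_{2m,ii}corr_{2m,ll})` (`m = dressSteps L`, insertions `flowLiftAt 0 (flowTime β L) g_i`). [cite: LuscherWolff1990] -/
theorem staticClauses_iff_corr (hβ : 0 < β) (hφ : IsPhys φ) (hg : ∀ i, IsPhys (g i)) (C : ℝ) :
    StaticClauses k C β (dressedLiftFamily β φ g) ↔
      let cF := corr β φ (fun i => flowLiftAt (L := L) 0 (flowTime β L) (g i))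
      let m := dressSteps L
      (∀ i : Fin k, 0 < cF (2 * m) i i) ∧
      (∀ i l : Fin k, i ≠ l →
        |cF (2 * m) i l| ≤ C * luscherLambda β L * (Real.sqrt (cF (2 * m) i i) * Real.sqrt (cF (2 * m) l l))) := by
  set l0 := levelValue su2Rep L β 0 with hl0
  have hl0pos : 0 < l0 := levelValue_su2Rep_pos hβ 0
  set m := dressSteps L with hm
  set G : Fin k → (GaugeConfig 3 L SU2 → ℝ) := fun i => flowLiftAt (L := L) 0 (flowTime β L) (g i) with hG
  have hGi : ∀ i, IsPhys (G i) := fun i => isPhys_flowLiftAt 0 _ (hg i)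
  have hnF : ∀ i l : Fin k, l2 (dressedLiftFamily β φ g i) (dressedLiftFamily β φ g l) = l0 ^ (2 * m) * corr β φ G (2 * m) i l :=
    fun i l => by simp only [dressedLiftFamily_apply]; exact corr_dressed_norm hβ hφ hGi m i l
  have hsF : ∀ i : Fin k, Real.sqrt (l2 (dressedLiftFamily β φ g i) (dressedLiftFamily β φ g i)) = l0 ^ m * Real.sqrt (corr β φ G (2 * m) i i) :=
    fun i => by rw [hnF, sqrt_pow_two_mul_mul hl0pos.le]
  have hP : 0 < l0 ^ (2 * m) := pow_pos hl0pos _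
  dsimp only
  unfold StaticClauses
  refine and_congr (forall_congr' fun i => ?_) (forall_congr' fun i => forall_congr' fun l => imp_congr_right fun _ => ?_)
  · exact pos_iff_of_eq_pos_mul hP (hnF i i)
  · refine le_iff_of_eq_pos_mul hP ?_ ?_
    · rw [hnF, abs_mul, abs_of_pos hP]
    · rw [hsF, hsF, show l0 ^ (2 * m) = l0 ^ m * l0 ^ m by rw [← pow_add]; ring_nf]; ring

/-- ★ **S-POS core in Euclidean currency**: `DynamicCoreClauses k C β (dressedLiftFamily β φ g)` ⟺ (o5) `corr_{2m+1,ii}·μ₀ ≤ e^{Cλ²/L}·μ_{i+1}·corr_{2m,ii}` and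
`μ_{i+1}·corr_{2m,ii} ≤ e^{Cλ²/L}·corr_{2m+1,ii}·μ₀` (μ_j the one-site levels at `B = oneSiteCoupling β L`) ∧ (o6) the normalised symmetrised off-diagonal defect
bound — no power of `λ₀` left. [cite: Luscher1983, §3] [cite: LuscherWolff1990] -/
theorem dynamicCoreClauses_iff_corr (hβ : 0 < β) (hφ : IsPhys φ) (hg : ∀ i, IsPhys (g i)) (C : ℝ) :
    DynamicCoreClauses k C β (dressedLiftFamily β φ g) ↔
      let cF := corr β φ (fun i => flowLiftAt (L := L) 0 (flowTime β L) (g i))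
      let m := dressSteps L
      (∀ i : Fin k,
        cF (2 * m + 1) i i * levelValue su2Rep 1 (oneSiteCoupling β L) 0 ≤
            Real.exp (C * luscherLambda β L ^ 2 / L) * (levelValue su2Rep 1 (oneSiteCoupling β L) ((i : ℕ) + 1) * cF (2 * m) i i) ∧
        levelValue su2Rep 1 (oneSiteCoupling β L) ((i : ℕ) + 1) * cF (2 * m) i i ≤
            Real.exp (C * luscherLambda β L ^ 2 / L) * (cF (2 * m + 1) i i * levelValue su2Rep 1 (oneSiteCoupling β L) 0)) ∧
      (∀ i l : Fin k, i ≠ l →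
        |cF (2 * m + 1) i l - (cF (2 * m + 1) i i / cF (2 * m) i i + cF (2 * m + 1) l l / cF (2 * m) l l) / 2 * cF (2 * m) i l|
          ≤ C * (luscherLambda β L ^ 2 / L) * (Real.sqrt (cF (2 * m) i i) * Real.sqrt (cF (2 * m) l l))) := by
  set l0 := levelValue su2Rep L β 0 with hl0
  have hl0pos : 0 < l0 := levelValue_su2Rep_pos hβ 0
  set m := dressSteps L with hm
  set G : Fin k → (GaugeConfig 3 L SU2 → ℝ) := fun i => flowLiftAt (L := L) 0 (flowTime β L) (g i) with hG
  have hGi : ∀ i, IsPhys (G i) := fun i => isPhys_flowLiftAt 0 _ (hg i)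
  have hnF : ∀ i l : Fin k, l2 (dressedLiftFamily β φ g i) (dressedLiftFamily β φ g l) = l0 ^ (2 * m) * corr β φ G (2 * m) i l :=
    fun i l => by simp only [dressedLiftFamily_apply]; exact corr_dressed_norm hβ hφ hGi m i l
  have hdF : ∀ i l : Fin k, l2 (dressedLiftFamily β φ g i) (transferApply β (dressedLiftFamily β φ g l)) =
      l0 ^ (2 * m + 1) * corr β φ G (2 * m + 1) i l :=
    fun i l => by simp only [dressedLiftFamily_apply]; exact corr_dressed_form hβ hφ hGi m i l
  have hsF : ∀ i : Fin k, Real.sqrt (l2 (dressedLiftFamily β φ g i) (dressedLiftFamily β φ g i)) = l0 ^ m * Real.sqrt (corr β φ G (2 * m) i i) :=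
    fun i => by rw [hnF, sqrt_pow_two_mul_mul hl0pos.le]
  have hρF : ∀ i : Fin k, l2 (dressedLiftFamily β φ g i) (transferApply β (dressedLiftFamily β φ g i)) /
      l2 (dressedLiftFamily β φ g i) (dressedLiftFamily β φ g i) = l0 * (corr β φ G (2 * m + 1) i i / corr β φ G (2 * m) i i) := fun i => by
    rw [hdF, hnF, pow_succ, show l0 ^ (2 * m) * l0 * corr β φ G (2 * m + 1) i i = l0 ^ (2 * m) * (l0 * corr β φ G (2 * m + 1) i i) by ring,
      mul_div_mul_left _ _ (pow_ne_zero _ hl0pos.ne'), mul_div_assoc]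
  have hP : 0 < l0 ^ (2 * m + 1) := pow_pos hl0pos _
  have hsplit : l0 ^ (2 * m + 1) = l0 * (l0 ^ m * l0 ^ m) := by rw [← pow_add, pow_succ]; ring_nf
  dsimp only
  unfold DynamicCoreClauses
  refine and_congr (forall_congr' fun i => and_congr ?_ ?_) (forall_congr' fun i => forall_congr' fun l => imp_congr_right fun _ => ?_)
  · refine le_iff_of_eq_pos_mul hP ?_ ?_
    · rw [hdF]; ring
    · rw [hnF, pow_succ]; ring
  · refine le_iff_of_eq_pos_mul hP ?_ ?_
    · rw [hnF, pow_succ]; ring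
    · rw [hdF]; ring
  · refine le_iff_of_eq_pos_mul hP ?_ ?_
    · rw [hdF, hρF, hρF, hnF, ← abs_of_pos hP, ← abs_mul, abs_of_pos hP]
      congr 1
      rw [pow_succ]; ring
    · rw [hsF, hsF, hsplit]; ring

/-- ★ **S-LEAK in Euclidean currency**: `LeakageClause k C β (dressedLiftFamily β φ g)` ⟺ (o4) the log-convexity defect of `t ↦ corr_t` at `t = 2m` is small:
`corr_{2m+2,ii}·corr_{2m,ii} − corr_{2m+1,ii}² ≤ C(λ³/L²)·corr_{2m,ii}²` (effective-mass PLATEAU between separations `2m, 2m+1, 2m+2`). [cite: LuscherWolff1990] -/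
theorem leakageClause_iff_corr (hβ : 0 < β) (hφ : IsPhys φ) (hg : ∀ i, IsPhys (g i)) (C : ℝ) :
    LeakageClause k C β (dressedLiftFamily β φ g) ↔
      let cF := corr β φ (fun i => flowLiftAt (L := L) 0 (flowTime β L) (g i))
      let m := dressSteps L
      ∀ i : Fin k,
        cF (2 * m + 2) i i * cF (2 * m) i i - cF (2 * m + 1) i i ^ 2 ≤ C * (luscherLambda β L ^ 3 / (L : ℝ) ^ 2) * cF (2 * m) i i ^ 2 := by
  set l0 := levelValue su2Rep L β 0 with hl0
  have hl0pos : 0 < l0 := levelValue_su2Rep_pos hβ 0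
  set m := dressSteps L with hm
  set G : Fin k → (GaugeConfig 3 L SU2 → ℝ) := fun i => flowLiftAt (L := L) 0 (flowTime β L) (g i) with hG
  have hGi : ∀ i, IsPhys (G i) := fun i => isPhys_flowLiftAt 0 _ (hg i)
  have hnF : ∀ i l : Fin k, l2 (dressedLiftFamily β φ g i) (dressedLiftFamily β φ g l) = l0 ^ (2 * m) * corr β φ G (2 * m) i l :=
    fun i l => by simp only [dressedLiftFamily_apply]; exact corr_dressed_norm hβ hφ hGi m i l
  have hdF : ∀ i l : Fin k, l2 (dressedLiftFamily β φ g i) (transferApply β (dressedLiftFamily β φ g l)) =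
      l0 ^ (2 * m + 1) * corr β φ G (2 * m + 1) i l :=
    fun i l => by simp only [dressedLiftFamily_apply]; exact corr_dressed_form hβ hφ hGi m i l
  have hkF : ∀ i l : Fin k, l2 (transferApply β (dressedLiftFamily β φ g i)) (transferApply β (dressedLiftFamily β φ g l)) =
      l0 ^ (2 * m + 2) * corr β φ G (2 * m + 2) i l :=
    fun i l => by simp only [dressedLiftFamily_apply]; exact corr_dressed_normK hβ hφ hGi m i l
  have hP : 0 < l0 ^ (4 * m + 2) := pow_pos hl0pos _
  have h1 : l0 ^ (2 * m + 2) * l0 ^ (2 * m) = l0 ^ (4 * m + 2) := by rw [← pow_add]; ring_nf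
  have h2 : l0 ^ (2 * m + 1) * l0 ^ (2 * m + 1) = l0 ^ (4 * m + 2) := by rw [← pow_add]; ring_nf
  have h3 : l0 ^ 2 * (l0 ^ (2 * m) * l0 ^ (2 * m)) = l0 ^ (4 * m + 2) := by rw [← pow_add, ← pow_add]; ring_nf
  dsimp only
  unfold LeakageClause
  refine forall_congr' fun i => le_iff_of_eq_pos_mul hP ?_ ?_
  · rw [hkF, hnF, hdF]
    calc l0 ^ (2 * m + 2) * corr β φ G (2 * m + 2) i i * (l0 ^ (2 * m) * corr β φ G (2 * m) i i) -
          (l0 ^ (2 * m + 1) * corr β φ G (2 * m + 1) i i) ^ 2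
        = l0 ^ (2 * m + 2) * l0 ^ (2 * m) * (corr β φ G (2 * m + 2) i i * corr β φ G (2 * m) i i) -
            l0 ^ (2 * m + 1) * l0 ^ (2 * m + 1) * corr β φ G (2 * m + 1) i i ^ 2 := by ring
      _ = _ := by rw [h1, h2]; ring
  · rw [hnF]
    calc C * (luscherLambda β L ^ 3 / (L : ℝ) ^ 2) * l0 ^ 2 * (l0 ^ (2 * m) * corr β φ G (2 * m) i i) ^ 2
        = l0 ^ 2 * (l0 ^ (2 * m) * l0 ^ (2 * m)) * (C * (luscherLambda β L ^ 3 / (L : ℝ) ^ 2) * corr β φ G (2 * m) i i ^ 2) := by ring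
      _ = _ := by rw [h3]

end Dressed

end Summit.QuantumFields.YangMills.Theorems.FemtoTransferGap.PolyakovLift

end
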